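import Summits.QuantumFields.YangMills.Theses.ParabolicTrajectory
import Summits.QuantumFields.YangMills.Theorems.TunedSequenceExists.Negative.Glue

/-!
# Crux `TunedSequenceExists` (stmt-QuantumFields-10524): the TYPED SPLIT of (S) into
# (U) `FemtoWindow`, (V) `VolumeMonotone`, (A) `CanonicalUpperBound` — definitions + landed glue
# (line `fixed-aspect-window`; lead c3, 2026-08-17)

The crux (conjunct (S) of route `ParabolicTrajectory`) has the kernel-certified open core
`CorrelatorWindowLowerBound r M`
(`∃ θ₀ > 0, ∀ B m₀ L₀, ∃ m ≥ m₀, ∃ L ≥ L₀M^m, ∃ β ≥ B, θ₀ ≤ u(β, m, L)`,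
`u(β, m, L) := (M^m)⁸ ⟨P ; τ_{M^m} P⟩_{β, 2L+1}`, `P = r.curvature.F`; tree
`Negative.Glue.weak_iff_lowerBound`, `Negative.Glue.lowerBound_of_tunedSequenceExists`).  Four line
leads closed every spatial localisation of that lower bound (DLR box, block conditioning, transport)
as `≥` the core.  The strategist's line `fixed-aspect-window`
(`Cruxes/TunedSequenceExists/Lines/fixed_aspect_window.lean`, `STRATEGY-CENSUS.md` § Decomposition D2)
splits the VOLUME QUANTIFIER instead; this file makes the three pieces and their composition
IMPORTABLE, so that a tenure `route edit --split TunedSequenceExists --into … --glue-by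
Summit.QuantumFields.YangMills.Theorems.TunedSequenceExists.FixedAspectSplit.tunedSequenceExists_of_subs`
acts on landed names (planners cannot write `Theorems/`):

* `FemtoWindowAll` — (U): the asymptotic-freedom-quantified window at PINNED aspect ratio `L₁`
  (torus side exactly `2L₁M^m + 1`, height `c / log² L₁` conceded to decay with the aspect; finite
  physical volume, every scale perturbative — Bałaban's setting plus two curvature insertions).
* `VolumeMonotoneAll` — (V): one-sided quasi-monotonicity of `u` in the volume at weak coupling with
  an `o(1/log² L₁)` finite-size defect (pure thermodynamic-limit content; no lower bound, no tuning).
* `CanonicalUpperBoundAll` — (A): the canonical-scaling UPPER bound `D⁸|⟨P ; τ_D P⟩_{β,2L+1}| ≤ K`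
  at weak coupling, all tori, all `D ≤ L` (the a-priori half of clause (iii)).
* `tunedSequenceExists_of_subs : FemtoWindowAll → VolumeMonotoneAll → CanonicalUpperBoundAll →
  TunedSequenceExists` — the glue, sorry-free: (U)+(V) ⇒ the core with `θ₀ = c/(2 log² L₁)`
  (`lowerBound_of_femto_of_volume`, quantifier arithmetic) ⇒ weak window with EXACT tuning (landed
  `Negative.Glue.weak_of_lowerBound`: β-continuity, freezing, IVT) ⇒ (A) bounds every `N_t`
  (`bounded_of_canonicalUpperBound`) ⇒ diagonal extraction (`witness_of_bounded`).
* § Certificates: (V) and (A) are inhabited by the zero table while the core's shape is not — neither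
  is `≥` the core (`volumeMonotoneShape_zero`, `canonicalUpperBoundShape_zero`,
  `not_lowerBoundShape_zero`).

The three sub-statements are OBLIGATION PIECES of our crux (not published facts; deliberately
untagged so that the gate does not relocate them).  Their bodies are, verbatim, the registered stubs
`stub_femtoWindow` / `stub_volumeMonotone` / `stub_canonicalUpperBound` of the line (skeleton sha
2d20e3a19f71).  References: Bałaban CMP 109/116/119/122 (U); Lüscher 1983/1986 (finite-size
effects, (U),(V)); Osterwalder–Seiler 1978 §2 (transfer-operator positivity, (A)).
-/

noncomputable section

open Filter Topology MeasureTheory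
open Literature.MathematicalPhysics.QuantumFieldTheory Literature.MathematicalPhysics.QuantumLattice
open Summit.QuantumFields.YangMills.Theorems.TunedSequenceExists.Negative.AtZeroFalse
  (eventually_sep_le_L)

namespace Summit.QuantumFields.YangMills.Theorems.TunedSequenceExists.FixedAspectSplit

/-! ## §1 The three sub-statements at fixed data `(G, r, M)` -/

section Statements

variable {G : Type} [Group G] [TopologicalSpace G] [IsTopologicalGroup G] [CompactSpace G]
  [MeasurableSpace G] [BorelSpace G]

/-- **(U) The asymptotic-freedom-quantified window at PINNED aspect ratio.**  There are `c > 0` and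
an aspect floor `LU` such that for every aspect ratio `L₁ ≥ max LU 2` and beyond every coupling floor
`B` and depth floor `m₀` some `m ≥ m₀`, `β ≥ B` give
`c / (log L₁)² ≤ (M^m)⁸ ⟨P ; τ_{M^m} P⟩_{β, 2 L₁ M^m + 1}` — the torus side is EXACTLY `2 L₁ M^m + 1`.
Obligation piece of the crux (line `fixed-aspect-window`, stub `stub_femtoWindow`); not a published
fact. -/
def FemtoWindow (r : LatticeRep G) (M : ℕ) : Prop :=
  ∃ c : ℝ, 0 < c ∧ ∃ LU : ℕ, ∀ L₁ : ℕ, LU ≤ L₁ → 2 ≤ L₁ → ∀ (B : ℝ) (m₀ : ℕ),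
    ∃ m : ℕ, m₀ ≤ m ∧ ∃ β : ℝ, B ≤ β ∧
      c / Real.log L₁ ^ 2 ≤ ((M : ℝ) ^ m) ^ 8 *
        latticeConnectedCorr r.ρ β (2 * (L₁ * M ^ m) + 1) r.curvature.F r.curvature.F (M ^ m)

/-- **(V) One-sided quasi-monotonicity in the volume at weak coupling.**  For every tolerance
constant `c > 0` there is an aspect floor `LV` such that for every aspect ratio `L₁ ≥ max LV 2` there
are `β₁, m₁` with: for all `β ≥ β₁`, `m ≥ m₁` and ALL `L ≥ L₁ M^m`,
`(M^m)⁸ ⟨P ; τ_{M^m} P⟩_{β, 2 L₁ M^m + 1} - c / (log L₁)² ≤ (M^m)⁸ ⟨P ; τ_{M^m} P⟩_{β, 2L+1}`.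
Obligation piece of the crux (stub `stub_volumeMonotone`); not a published fact. -/
def VolumeMonotone (r : LatticeRep G) (M : ℕ) : Prop :=
  ∀ c : ℝ, 0 < c → ∃ LV : ℕ, ∀ L₁ : ℕ, LV ≤ L₁ → 2 ≤ L₁ → ∃ (β₁ : ℝ) (m₁ : ℕ),
    ∀ (β : ℝ) (m L : ℕ), β₁ ≤ β → m₁ ≤ m → L₁ * M ^ m ≤ L →
      ((M : ℝ) ^ m) ^ 8 *
          latticeConnectedCorr r.ρ β (2 * (L₁ * M ^ m) + 1) r.curvature.F r.curvature.F (M ^ m) -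
        c / Real.log L₁ ^ 2 ≤
      ((M : ℝ) ^ m) ^ 8 *
          latticeConnectedCorr r.ρ β (2 * L + 1) r.curvature.F r.curvature.F (M ^ m)

/-- **(A) Canonical-scaling upper bound at weak coupling** (the a-priori half of clause (iii)):
`D⁸ |⟨P ; τ_D P⟩_{β, 2L+1}| ≤ K` for all `β ≥ β₁`, all `L`, all separations `D ≤ L`.
Obligation piece of the crux (stub `stub_canonicalUpperBound`); not a published fact. -/
def CanonicalUpperBound (r : LatticeRep G) : Prop :=
  ∃ (β₁ K : ℝ), ∀ β : ℝ, β₁ ≤ β → ∀ (L D : ℕ), D ≤ L →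
    (D : ℝ) ^ 8 * |latticeConnectedCorr r.ρ β (2 * L + 1) r.curvature.F r.curvature.F D| ≤ K

end Statements

/-- **(U) under the crux's quantifier prefix** — child `FemtoWindow` of the recommended split.
Body = registered stub `stub_femtoWindow` verbatim. -/
def FemtoWindowAll : Prop :=
  ∀ (G : Type) [Group G] [TopologicalSpace G] [IsTopologicalGroup G] [CompactSpace G],
    IsCompactSimpleLieGroup G → letI : MeasurableSpace G := borel G
    haveI : BorelSpace G := ⟨rfl⟩
    ∀ (r : LatticeRep G) (M : ℕ), 2 ≤ M →
    ∃ c : ℝ, 0 < c ∧ ∃ LU : ℕ, ∀ L₁ : ℕ, LU ≤ L₁ → 2 ≤ L₁ → ∀ (B : ℝ) (m₀ : ℕ),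
      ∃ m : ℕ, m₀ ≤ m ∧ ∃ β : ℝ, B ≤ β ∧
        c / Real.log L₁ ^ 2 ≤ ((M : ℝ) ^ m) ^ 8 *
          latticeConnectedCorr r.ρ β (2 * (L₁ * M ^ m) + 1) r.curvature.F r.curvature.F (M ^ m)

/-- **(V) under the crux's quantifier prefix** — child `VolumeMonotone` of the recommended split.
Body = registered stub `stub_volumeMonotone` verbatim. -/
def VolumeMonotoneAll : Prop :=
  ∀ (G : Type) [Group G] [TopologicalSpace G] [IsTopologicalGroup G] [CompactSpace G],
    IsCompactSimpleLieGroup G → letI : MeasurableSpace G := borel G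
    haveI : BorelSpace G := ⟨rfl⟩
    ∀ (r : LatticeRep G) (M : ℕ), 2 ≤ M →
    ∀ c : ℝ, 0 < c → ∃ LV : ℕ, ∀ L₁ : ℕ, LV ≤ L₁ → 2 ≤ L₁ → ∃ (β₁ : ℝ) (m₁ : ℕ),
      ∀ (β : ℝ) (m L : ℕ), β₁ ≤ β → m₁ ≤ m → L₁ * M ^ m ≤ L →
        ((M : ℝ) ^ m) ^ 8 *
            latticeConnectedCorr r.ρ β (2 * (L₁ * M ^ m) + 1) r.curvature.F r.curvature.F (M ^ m) -
          c / Real.log L₁ ^ 2 ≤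
        ((M : ℝ) ^ m) ^ 8 *
            latticeConnectedCorr r.ρ β (2 * L + 1) r.curvature.F r.curvature.F (M ^ m)

/-- **(A) under the crux's quantifier prefix** (no `M`) — child `CanonicalUpperBound` of the
recommended split.  Body = registered stub `stub_canonicalUpperBound` verbatim. -/
def CanonicalUpperBoundAll : Prop :=
  ∀ (G : Type) [Group G] [TopologicalSpace G] [IsTopologicalGroup G] [CompactSpace G],
    IsCompactSimpleLieGroup G → letI : MeasurableSpace G := borel G
    haveI : BorelSpace G := ⟨rfl⟩
    ∀ (r : LatticeRep G),
    ∃ (β₁ K : ℝ), ∀ β : ℝ, β₁ ≤ β → ∀ (L D : ℕ), D ≤ L →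
      (D : ℝ) ^ 8 * |latticeConnectedCorr r.ρ β (2 * L + 1) r.curvature.F r.curvature.F D| ≤ K

/-! ## §2 Glue (sorry-free) -/

section Glue

/-- An eventually bounded real sequence is bounded. -/
theorem exists_bound_of_eventually {u : ℕ → ℝ} {C : ℝ} (h : ∀ᶠ k in atTop, |u k| ≤ C) :
    ∃ C' : ℝ, ∀ k, |u k| ≤ C' := by
  obtain ⟨K, hK⟩ := eventually_atTop.1 h
  refine ⟨max C (∑ j ∈ Finset.range K, |u j|), fun k => ?_⟩
  rcases lt_or_ge k K with hk | hk
  · exact le_max_of_le_right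
      (Finset.single_le_sum (fun j _ => abs_nonneg (u j)) (Finset.mem_range.2 hk))
  · exact le_max_of_le_left (hK k hk)

variable {ι : Type}

/-- Re-indexing a scaling scheme along a strictly increasing `φ : ℕ → ℕ` (a subsequence of a
scheme is a scheme). -/
def reindex (sch : SpeciesScheme ι) (φ : ℕ → ℕ) (hφ : StrictMono φ) : SpeciesScheme ι where
  a := sch.a ∘ φ
  a_pos k := sch.a_pos (φ k)
  tendsto_a := sch.tendsto_a.comp hφ.tendsto_atTop
  β := sch.β ∘ φ
  L := sch.L ∘ φ
  tendsto_L := sch.tendsto_L.comp hφ.tendsto_atTop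
  c s := sch.c s ∘ φ
  m s := sch.m s ∘ φ

/-- Spacings of the re-indexed scheme. -/
@[simp] theorem reindex_a (sch : SpeciesScheme ι) (φ : ℕ → ℕ) (hφ : StrictMono φ) (k : ℕ) :
    (reindex sch φ hφ).a k = sch.a (φ k) := rfl

/-- Couplings of the re-indexed scheme. -/
@[simp] theorem reindex_β (sch : SpeciesScheme ι) (φ : ℕ → ℕ) (hφ : StrictMono φ) (k : ℕ) :
    (reindex sch φ hφ).β k = sch.β (φ k) := rfl

/-- Torus sides of the re-indexed scheme. -/
@[simp] theorem reindex_side (sch : SpeciesScheme ι) (φ : ℕ → ℕ) (hφ : StrictMono φ) (k : ℕ) :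
    (reindex sch φ hφ).side k = sch.side (φ k) := rfl

variable {G : Type} [Group G] [TopologicalSpace G] [IsTopologicalGroup G] [CompactSpace G]
  [MeasurableSpace G] [BorelSpace G]

/-- **Diagonal extraction**: a tuned `M`-adic witness with `β_k → ∞` along which every `N_t` is
BOUNDED has a re-indexing along which every `N_t` converges — the crux's clause (iii). -/
theorem witness_of_bounded (r : LatticeRep G) (M : ℕ) (θ : ℝ) (sch : SpeciesScheme (YMSpecies G))
    (n : ℕ → ℕ) (hshape : ∀ k, sch.a k = ((M : ℝ) ^ n k)⁻¹) (hβ : Tendsto sch.β atTop atTop)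
    (hbdd : ∀ t : ℕ, 0 < t → ∃ C : ℝ, ∀ k, |((M : ℝ) ^ n k) ^ 8 *
        latticeConnectedCorr r.ρ (sch.β k) (sch.side k) r.curvature.F r.curvature.F
          (t * M ^ n k)| ≤ C)
    (hlim : Tendsto (fun k => ((M : ℝ) ^ n k) ^ 8 *
        latticeConnectedCorr r.ρ (sch.β k) (sch.side k) r.curvature.F r.curvature.F
          (M ^ n k)) atTop (𝓝 θ)) :
    ∃ (sch' : SpeciesScheme (YMSpecies G)) (n' : ℕ → ℕ),
      (∀ k, sch'.a k = ((M : ℝ) ^ n' k)⁻¹) ∧ Tendsto sch'.β atTop atTop ∧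
      (∀ t : ℕ, 0 < t → ∃ c : ℝ, Tendsto (fun k => ((M : ℝ) ^ n' k) ^ 8 *
          latticeConnectedCorr r.ρ (sch'.β k) (sch'.side k) r.curvature.F r.curvature.F
            (t * M ^ n' k)) atTop (𝓝 c)) ∧
      Tendsto (fun k => ((M : ℝ) ^ n' k) ^ 8 *
          latticeConnectedCorr r.ρ (sch'.β k) (sch'.side k) r.curvature.F r.curvature.F
            (M ^ n' k)) atTop (𝓝 θ) := by
  set u : ℕ → ℕ → ℝ := fun k t' => ((M : ℝ) ^ n k) ^ 8 *
    latticeConnectedCorr r.ρ (sch.β k) (sch.side k) r.curvature.F r.curvature.F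
      ((t' + 1) * M ^ n k) with hu
  choose C hC using fun t' : ℕ => hbdd (t' + 1) (Nat.succ_pos t')
  set K : Set (ℕ → ℝ) := Set.pi Set.univ fun t' => Set.Icc (-C t') (C t') with hK
  have hKc : IsCompact K := isCompact_univ_pi fun t' => isCompact_Icc
  have huK : ∀ k, u k ∈ K := fun k => by
    simp only [hK, Set.mem_pi, Set.mem_univ, true_implies, Set.mem_Icc]
    intro t'
    exact abs_le.1 (hC t' k)
  obtain ⟨lim, -, φ, hφ, hconv⟩ := hKc.tendsto_subseq huK
  refine ⟨reindex sch φ hφ, n ∘ φ, fun k => hshape (φ k), hβ.comp hφ.tendsto_atTop, ?_, ?_⟩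
  · intro t ht
    obtain ⟨t', rfl⟩ := Nat.exists_eq_succ_of_ne_zero ht.ne'
    refine ⟨lim t', ?_⟩
    have h1 : Tendsto (fun j => u (φ j) t') atTop (𝓝 (lim t')) := tendsto_pi_nhds.1 hconv t'
    refine h1.congr fun j => ?_
    simp only [hu, Function.comp_apply, reindex_β, reindex_side, Nat.succ_eq_add_one]
  · exact hlim.comp hφ.tendsto_atTop

/-- **(U) + (V) ⇒ the finite-volume correlator window lower bound** (`CorrelatorWindowLowerBound`,
the crux core) with `θ₀ = c / (2 log² L₁)`: pure quantifier arithmetic — the aspect ratio `L₁` and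
the constant `c` are fixed BEFORE the floors `B, m₀, L₀`. -/
theorem lowerBound_of_femto_of_volume (r : LatticeRep G) {M : ℕ} (hU : FemtoWindow r M)
    (hV : VolumeMonotone r M) :
    ∃ θ₀ : ℝ, 0 < θ₀ ∧ ∀ (B : ℝ) (m₀ L₀ : ℕ), ∃ m : ℕ, m₀ ≤ m ∧ ∃ L : ℕ, L₀ * M ^ m ≤ L ∧
      ∃ β : ℝ, B ≤ β ∧ θ₀ ≤ ((M : ℝ) ^ m) ^ 8 *
        latticeConnectedCorr r.ρ β (2 * L + 1) r.curvature.F r.curvature.F (M ^ m) := by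
  obtain ⟨c, hc, LU, hU⟩ := hU
  obtain ⟨LV, hV⟩ := hV (c / 2) (half_pos hc)
  -- the aspect ratio: beyond both floors and at least 2
  set L₁ : ℕ := max (max LU LV) 2 with hL₁
  have hLU : LU ≤ L₁ := (le_max_left _ _).trans (le_max_left _ _)
  have hLV : LV ≤ L₁ := (le_max_right _ _).trans (le_max_left _ _)
  have h2 : 2 ≤ L₁ := le_max_right _ _
  have hlog : 0 < Real.log (L₁ : ℝ) := Real.log_pos (by exact_mod_cast h2)
  obtain ⟨β₁, m₁, hV'⟩ := hV L₁ hLV h2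
  refine ⟨c / 2 / Real.log L₁ ^ 2, by positivity, fun B m₀ L₀ => ?_⟩
  obtain ⟨m, hm, β, hβ, hu⟩ := hU L₁ hLU h2 (max B β₁) (max m₀ m₁)
  refine ⟨m, (le_max_left _ _).trans hm, max L₀ L₁ * M ^ m,
    Nat.mul_le_mul_right _ (le_max_left _ _), β, (le_max_left _ _).trans hβ, ?_⟩
  have hstep := hV' β m (max L₀ L₁ * M ^ m) ((le_max_right _ _).trans hβ)
    ((le_max_right _ _).trans hm) (Nat.mul_le_mul_right _ (le_max_right _ _))
  have hhalf : c / 2 / Real.log (L₁ : ℝ) ^ 2 = c / Real.log L₁ ^ 2 - c / 2 / Real.log L₁ ^ 2 := by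
    ring
  linarith

/-- **(A) ⇒ the a-priori bound**: along any `M`-adic scheme with `β_k → ∞`, every rescaled
correlator `N_t`, `t ≥ 1`, is bounded (`|N_t(k)| ≤ K / t⁸ ≤ K` eventually; finitely many early
`k`). -/
theorem bounded_of_canonicalUpperBound (r : LatticeRep G) {M : ℕ} (hA : CanonicalUpperBound r)
    (sch : SpeciesScheme (YMSpecies G)) (n : ℕ → ℕ) (hshape : ∀ k, sch.a k = ((M : ℝ) ^ n k)⁻¹)
    (hβ : Tendsto sch.β atTop atTop) (t : ℕ) (ht : 0 < t) :
    ∃ C : ℝ, ∀ k, |((M : ℝ) ^ n k) ^ 8 *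
        latticeConnectedCorr r.ρ (sch.β k) (sch.side k) r.curvature.F r.curvature.F
          (t * M ^ n k)| ≤ C := by
  obtain ⟨β₁, K, hK⟩ := hA
  refine exists_bound_of_eventually (C := K) ?_
  filter_upwards [tendsto_atTop.1 hβ β₁, eventually_sep_le_L sch hshape t] with k hk1 hk2
  have h := hK (sch.β k) hk1 (sch.L k) (t * M ^ n k) hk2
  have hpow : (0 : ℝ) ≤ ((M : ℝ) ^ n k) ^ 8 := by positivity
  have ht1 : (1 : ℝ) ≤ t := by exact_mod_cast ht
  have hle : ((M : ℝ) ^ n k) ^ 8 ≤ ((t * M ^ n k : ℕ) : ℝ) ^ 8 := by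
    push_cast
    gcongr
    exact le_mul_of_one_le_left (by positivity) ht1
  rw [abs_mul, abs_of_nonneg hpow]
  calc ((M : ℝ) ^ n k) ^ 8 *
        |latticeConnectedCorr r.ρ (sch.β k) (sch.side k) r.curvature.F r.curvature.F (t * M ^ n k)|
      ≤ ((t * M ^ n k : ℕ) : ℝ) ^ 8 *
        |latticeConnectedCorr r.ρ (sch.β k) (sch.side k) r.curvature.F r.curvature.F (t * M ^ n k)| :=
        mul_le_mul_of_nonneg_right hle (abs_nonneg _)
    _ ≤ K := by simpa [SpeciesScheme.side] using h

/-- **The crux body at fixed `(G, r, M)`, `M ≥ 2`, from (U), (V), (A)**: lower bound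
(`lowerBound_of_femto_of_volume`) ⇒ weak window with EXACT tuning (landed
`Negative.Glue.weak_of_lowerBound`) ⇒ a-priori bound (`bounded_of_canonicalUpperBound`) ⇒ diagonal
extraction (`witness_of_bounded`). -/
theorem window_of_subs (r : LatticeRep G) {M : ℕ} (hM : 2 ≤ M) (hU : FemtoWindow r M)
    (hV : VolumeMonotone r M) (hA : CanonicalUpperBound r) :
    ∃ θ₀ : ℝ, 0 < θ₀ ∧ ∀ θ : ℝ, 0 < θ → θ < θ₀ →
      ∃ (sch : SpeciesScheme (YMSpecies G)) (n : ℕ → ℕ),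
        (∀ k, sch.a k = ((M : ℝ) ^ n k)⁻¹) ∧ Tendsto sch.β atTop atTop ∧
        (∀ t : ℕ, 0 < t → ∃ c : ℝ, Tendsto (fun k => ((M : ℝ) ^ n k) ^ 8 *
            latticeConnectedCorr r.ρ (sch.β k) (sch.side k) r.curvature.F r.curvature.F
              (t * M ^ n k)) atTop (𝓝 c)) ∧
        Tendsto (fun k => ((M : ℝ) ^ n k) ^ 8 *
            latticeConnectedCorr r.ρ (sch.β k) (sch.side k) r.curvature.F r.curvature.F
              (M ^ n k)) atTop (𝓝 θ) := by
  obtain ⟨θ₀, hθ₀, hweak⟩ :=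
    Negative.Glue.weak_of_lowerBound r hM (lowerBound_of_femto_of_volume r hU hV)
  refine ⟨θ₀, hθ₀, fun θ hθ hθ' => ?_⟩
  obtain ⟨sch, n, hshape, hβ, hlim⟩ := hweak θ hθ hθ'
  exact witness_of_bounded r M θ sch n hshape hβ
    (fun t ht => bounded_of_canonicalUpperBound r hA sch n hshape hβ t ht) hlim

end Glue

/-! ## §3 The composition: (U), (V), (A) imply the crux, BY NAME -/

/-- **Split glue `tunedSequenceExists_of_subs`** — `FemtoWindowAll → VolumeMonotoneAll →
CanonicalUpperBoundAll → Summit.QuantumFields.YangMills.Theses.ParabolicTrajectory.TunedSequenceExists`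
(sorry-free; the `--glue-by` declaration for the recommended route-level split of (S)). -/
theorem tunedSequenceExists_of_subs (hU : FemtoWindowAll) (hV : VolumeMonotoneAll)
    (hA : CanonicalUpperBoundAll) :
    Summit.QuantumFields.YangMills.Theses.ParabolicTrajectory.TunedSequenceExists := by
  intro G _ _ _ _ hG
  letI : MeasurableSpace G := borel G
  haveI : BorelSpace G := ⟨rfl⟩
  intro r M hM
  exact window_of_subs r hM (hU G hG r M hM) (hV G hG r M hM) (hA G hG r)

/-! ## §4 Size certificates (kernel-checked): neither (V) nor (A) is the crux core

(V) alone and (A) alone are inhabited by the ZERO correlator table (they have no lower-bound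
content), whereas the core's shape fails for it — so neither is `≥` `CorrelatorWindowLowerBound`
(the mechanism by which every round-1 stub died). (U) pins the torus side to `2 L₁ M^m + 1` with
height `c / log² L₁ → 0`, so it yields no `θ₀` uniform in the volume floor `L₀`. -/

section Certificates

/-- Shape of (V) for an abstract table `u : ℝ → ℕ → ℕ → ℝ` (coupling, depth, half-side). -/
def VolumeMonotoneShape (u : ℝ → ℕ → ℕ → ℝ) (M : ℕ) : Prop :=
  ∀ c : ℝ, 0 < c → ∃ LV : ℕ, ∀ L₁ : ℕ, LV ≤ L₁ → 2 ≤ L₁ → ∃ (β₁ : ℝ) (m₁ : ℕ),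
    ∀ (β : ℝ) (m L : ℕ), β₁ ≤ β → m₁ ≤ m → L₁ * M ^ m ≤ L →
      u β m (L₁ * M ^ m) - c / Real.log L₁ ^ 2 ≤ u β m L

/-- Shape of the core lower bound for an abstract table. -/
def LowerBoundShape (u : ℝ → ℕ → ℕ → ℝ) (M : ℕ) : Prop :=
  ∃ θ₀ : ℝ, 0 < θ₀ ∧ ∀ (B : ℝ) (m₀ L₀ : ℕ), ∃ m : ℕ, m₀ ≤ m ∧ ∃ L : ℕ, L₀ * M ^ m ≤ L ∧
    ∃ β : ℝ, B ≤ β ∧ θ₀ ≤ u β m L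

/-- Shape of (A) for an abstract correlator `C : ℝ → ℕ → ℕ → ℝ` (coupling, half-side, separation). -/
def CanonicalUpperBoundShape (C : ℝ → ℕ → ℕ → ℝ) : Prop :=
  ∃ (β₁ K : ℝ), ∀ β : ℝ, β₁ ≤ β → ∀ (L D : ℕ), D ≤ L → (D : ℝ) ^ 8 * |C β L D| ≤ K

/-- (V) at fixed data IS its shape applied to Wilson's rescaled correlator table (definitional). -/
theorem volumeMonotone_iff_shape {G : Type} [Group G] [TopologicalSpace G] [IsTopologicalGroup G]
    [CompactSpace G] [MeasurableSpace G] [BorelSpace G] (r : LatticeRep G) (M : ℕ) :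
    VolumeMonotone r M ↔ VolumeMonotoneShape (fun β m L => ((M : ℝ) ^ m) ^ 8 *
      latticeConnectedCorr r.ρ β (2 * L + 1) r.curvature.F r.curvature.F (M ^ m)) M :=
  Iff.rfl

/-- (A) at fixed data IS its shape applied to Wilson's correlator (definitional). -/
theorem canonicalUpperBound_iff_shape {G : Type} [Group G] [TopologicalSpace G]
    [IsTopologicalGroup G] [CompactSpace G] [MeasurableSpace G] [BorelSpace G] (r : LatticeRep G) :
    CanonicalUpperBound r ↔ CanonicalUpperBoundShape (fun β L D =>
      latticeConnectedCorr r.ρ β (2 * L + 1) r.curvature.F r.curvature.F D) :=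
  Iff.rfl

/-- (V)'s shape holds for the zero table … -/
theorem volumeMonotoneShape_zero (M : ℕ) : VolumeMonotoneShape (fun _ _ _ => 0) M := by
  intro c hc
  refine ⟨0, fun L₁ _ h2 => ⟨0, 0, fun β m L _ _ _ => ?_⟩⟩
  have hlog : 0 < Real.log (L₁ : ℝ) := Real.log_pos (by exact_mod_cast h2)
  have : 0 ≤ c / Real.log (L₁ : ℝ) ^ 2 := by positivity
  linarith

/-- … while the core's shape fails for it: (V) has no lower-bound content. -/
theorem not_lowerBoundShape_zero (M : ℕ) : ¬ LowerBoundShape (fun _ _ _ => 0) M := by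
  rintro ⟨θ₀, hθ₀, h⟩
  obtain ⟨m, -, L, -, β, -, hle⟩ := h 0 0 0
  exact absurd hle (not_le.2 hθ₀)

/-- (A)'s shape holds for the zero correlator (no lower-bound content either). -/
theorem canonicalUpperBoundShape_zero : CanonicalUpperBoundShape (fun _ _ _ => 0) :=
  ⟨0, 0, fun β _ L D _ => by simp⟩

end Certificates

end Summit.QuantumFields.YangMills.Theorems.TunedSequenceExists.FixedAspectSplit

end
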